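/-
Copyright: the b2b-balaban cell (near-miss cell 7), T⁴-continuum fan-out; row NE7b ROUND-2 swarm, seat
t4-ne7b-formalise-leaf-03 (gen 2) (row S12 «ASSEMBLY», sub-row S12e «THE MULTIPLICITY SOCKET END» of
`t4/b2b-balaban-t4-ne7b-p1/LEAVES-NE7b.md`, ruling R-OWNER-22-24 (2), R-S12e-1 ∕ R-OWNER-22-25 (3), finding F-leaf10g5-1;
node A12-I.M of the typer's `t4/formal/NE7b/DAG.md`).  Released under the licence of the surrounding project.
-/
import Summits.QuantumFields.BalabanUV.T4Continuum.Support.HistoryAssemblyMult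
import Summits.QuantumFields.BalabanUV.T4Continuum.Support.HistoryAssemblyMultRealise

/-!
# History assembly, MULTIPLICITY-KEYED: the occupant key with an ABSTRACT physical reading (order-free by choice)

Summits-side support file of the T⁴-continuum cell (rung (B)+1 on a FINITE torus only; NOT infinite volume, NOT the
mass gap, NOT the Clay statement; NOT a proof of the spine estimate NE7b).  Sub-row S12e «THE MULTIPLICITY SOCKET END»
(R-OWNER-22-24 (2)) of row S12, node A12-I.M of the typer's `t4/formal/NE7b/DAG.md`: the instantiation of the generic
multiplicity-keyed layer `HistoryAssemblyMult` (abstract key `ω`, `gmem`, `gslot`) for terms read as pedigrees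
(`HistoryAssemblyPedigree.memOf`, reading map `ped`∕`liveC`∕`cellOf`; sibling of `HistoryAssemblyMultRealise`, whose
`injOn_named` it reuses) with the PHYSICAL component of the key left as a
PARAMETER `phys : ℕ → ι → α → δ` — the datum by which H3 ∕ row S6g′'s instance identify «the same physical live
component» across terms.  [folklore] finite bookkeeping over the cell's own carriers; nothing printed asserted, no
`[cite:]` tag, no `Prop`-valued fact minted (trigger c1).

WHY A PARAMETER (leaf-10 g5's finding F-leaf10g5-1 on the sibling layer `HistoryAssemblyMultRealise`, whose key is the
ORDERED name-free carrier `Pedigree.toPGen`).  Exchanging the payloads of two equal-shape sibling sub-trees gives a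
different ordered carrier of the SAME physical component at the SAME tree slot; under the displayed reading (no listing
convention beyond «oldest line first») both orders occur, so an ordered key counts `∏ k_g!` orbit elements where row
S6g′'s count (`Sorted` placements of the ρ-tie-broken twin) counts orbits.  The kernel needs NOTHING of the physical
component of the key (prices go through the named members by a maximum over realisers; slots and within-term
injectivity come from the root cell and the flat genealogy); so the END leaves it abstract and the instance seat takes
`phys K τ c :=` the datum its injection is a function of — e.g. (templates, tie-broken sorted placement) of the sorted twin,
or the multiset of physical births — making «injective on the slot» true by construction and H3's displayed
resummation range over the histories with the SAME physical data.

WHAT.  §1 **`keyOf K τ c := (cellOf K τ c, (ped K τ).gen c, phys K τ c)`** (root cell, FLAT genealogy = the slot's shape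
tree by leaf-09's `relabel_shape_genT`, physical datum), **`kmemOf K τ`** (its image over the live components), the slot
**`kslot (x, G, _) := ⟨G.rootStep, x, G⟩`** with **`bslotOf_eq_kslot`** (hypothesis-free), the two compatibilities of
the generic layer **`image_kslot_kmemOf`** ∕ **`injOn_kslot_kmemOf`** (distinct root cells), a `DecidableEq` hint.
§2 **`koccOf`** = `HistoryAssemblyMult.gocc` for this key — THE DISTINCT (root cell, flat genealogy, physical datum)
TRIPLES OF BAD TERMS' LIVE COMPONENTS AT A TREE SLOT — with `mem_koccOf`.  §3 the kernel's per-key price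
**`supPriceK`** (maximum of an abstract named price `pr` over the key's realisers), `pr_le_supPriceK`,
`exists_realiser_eq_supPriceK`, **`prod_memOf_le_prod_supPriceK`**, **`hocc_of_boundK`** (the generic per-occupant
binder of `HistoryAssemblyMult.hF_of_multReading` from a per-realiser bound `#koccOf (slot) · pr ≤ priceT`).

HONEST DEPENDENCY (cell): continuum YM on T⁴ ⇐ BetaPertH ∧ nine spine estimates (0/9 proved); BetaPertH ⇐ (D1) ∧ (D4)
∧ CAP+tail.  Nothing of H3 ∕ (B) ∕ BetaPertH is discharged here; NE7b is NOT proved; no date.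
-/

open Finset
open Literature.MathematicalPhysics.QuantumFieldTheory.Balaban1983to89
open T4PersistenceDictionary T4PersistentHistoryCount T4BankedInduction T4PrintedShapeBanking
open T4LiveClassFibration T4LiveStructureGas T4BranchingRecordsGas T4TaggedShapeBanking T4PartnerMultiplicity
open Summit.QuantumFields.BalabanUV.T4Continuum.LateMergers
open Summit.QuantumFields.BalabanUV.T4Continuum.HistorySocketTH
open Summit.QuantumFields.BalabanUV.T4Continuum.HistoryAssemblyTerms
open Summit.QuantumFields.BalabanUV.T4Continuum.HistoryAssemblyTermsLE
open Summit.QuantumFields.BalabanUV.T4Continuum.HistoryAssemblyPedigree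
open Summit.QuantumFields.BalabanUV.T4Continuum.HistoryGen
open Summit.QuantumFields.BalabanUV.T4Continuum.HistoryAssemblyMult
open Summit.QuantumFields.BalabanUV.T4Continuum.HistoryAssemblyMultRealise

namespace Summit.QuantumFields.BalabanUV.T4Continuum.HistoryAssemblyMultKey

noncomputable section

/-! ## §1 The key of a live component: root cell, flat genealogy, physical datum -/

section Key

variable {ι α π γ δ : Type*} [DecidableEq α] [DecidableEq π] [DecidableEq γ] [DecidableEq δ]

/-- **THE KEY OF A LIVE COMPONENT** `c` of term `τ` at cutoff `K`: its root cell, its FLAT genealogy (the tree slot's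
shape tree) and its PHYSICAL DATUM `phys K τ c` — the abstract reading by which two terms are recognised to contain the
same physical live component (chosen by the consumer: e.g. the templates and tie-broken sorted placement of the sorted
twin, or the multiset of physical births). [folklore] -/
def keyOf (ped : ℕ → ι → Pedigree α π) (cellOf : ℕ → ι → α → γ) (phys : ℕ → ι → α → δ) (K : ℕ) (τ : ι) (c : α) :
    γ × Gen PEv × δ :=
  (cellOf K τ c, (ped K τ).gen c, phys K τ c)

/-- **THE KEY FAMILY** of a term: the keys of its live components. [folklore] -/
def kmemOf (ped : ℕ → ι → Pedigree α π) (liveC : ℕ → ι → Finset α) (cellOf : ℕ → ι → α → γ)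
    (phys : ℕ → ι → α → δ) (K : ℕ) (τ : ι) : Finset (γ × Gen PEv × δ) :=
  (liveC K τ).image (keyOf ped cellOf phys K τ)

/-- **THE TREE SLOT OF A KEY**: (root step, root cell, flat genealogy); the physical datum is not read. [folklore] -/
def kslot (w : γ × Gen PEv × δ) : BSlot γ PEv := ⟨w.2.1.rootStep, w.1, w.2.1⟩

/-- decidable equality of finite key families — named, so that instance search finds it under `fibre` ∕ `badGMems`.
[folklore] -/
instance instDecidableEqFinsetKey : DecidableEq (Finset (γ × Gen PEv × δ)) := @Finset.decidableEq _ inferInstance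

omit [DecidableEq α] [DecidableEq π] in
/-- membership in the key family. [folklore] -/
theorem mem_kmemOf {ped : ℕ → ι → Pedigree α π} {liveC : ℕ → ι → Finset α} {cellOf : ℕ → ι → α → γ}
    {phys : ℕ → ι → α → δ} {K : ℕ} {τ : ι} {w : γ × Gen PEv × δ} :
    w ∈ kmemOf ped liveC cellOf phys K τ ↔ ∃ c ∈ liveC K τ, keyOf ped cellOf phys K τ c = w := mem_image

omit [DecidableEq γ] [DecidableEq δ] in
/-- **THE KEY'S SLOT IS THE NAMED MEMBER'S SLOT** (hypothesis-free: leaf-09's one shape function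
`relabel (shape ∘ Prod.fst) (genT c) = gen c` and `rootStep_gen`). [folklore] -/
theorem bslotOf_eq_kslot (P : Pedigree α π) (x : γ) (c : α) (z : δ) :
    bslotOf Prod.fst (x, P.genT c) = kslot (x, P.gen c, z) := by
  show (⟨(P.genT c).rootStep, x, relabel (shape ∘ Prod.fst) (P.genT c)⟩ : BSlot γ PEv) = ⟨(P.gen c).rootStep, x, P.gen c⟩
  rw [P.relabel_shape_genT c, P.rootStep_gen c]

variable {ped : ℕ → ι → Pedigree α π} {liveC : ℕ → ι → Finset α} {cellOf : ℕ → ι → α → γ} {phys : ℕ → ι → α → δ}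
  {K : ℕ} {τ : ι}

/-- **COMPATIBILITY 1: THE SLOT FAMILY OF THE KEY FAMILY IS THE TERM'S LIVE CLASS** `bstrOf`. [folklore] -/
theorem image_kslot_kmemOf :
    (kmemOf ped liveC cellOf phys K τ).image kslot = bstrOf Prod.fst (memOf ped liveC cellOf) K τ := by
  rw [kmemOf, bstrOf, memOf, image_image, image_image]
  refine image_congr fun c _ => ?_
  show kslot (keyOf ped cellOf phys K τ c) = bslotOf Prod.fst (cellOf K τ c, (ped K τ).genT c)
  rw [bslotOf_eq_kslot (ped K τ) (cellOf K τ c) c (phys K τ c)]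
  rfl

omit [DecidableEq α] [DecidableEq π] in
/-- **COMPATIBILITY 2: DISTINCT KEYS OF ONE TERM SIT AT DISTINCT SLOTS** (distinct live components have distinct root
cells). [folklore] -/
theorem injOn_kslot_kmemOf (hinj : Set.InjOn (cellOf K τ) (liveC K τ : Set α)) :
    Set.InjOn kslot (kmemOf ped liveC cellOf phys K τ : Set (γ × Gen PEv × δ)) := by
  classical
  intro w hw w' hw' h
  obtain ⟨c, hc, rfl⟩ := mem_kmemOf.1 (Finset.mem_coe.1 hw)
  obtain ⟨c', hc', rfl⟩ := mem_kmemOf.1 (Finset.mem_coe.1 hw')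
  have hcell : cellOf K τ c = cellOf K τ c' := by
    have := congrArg (fun s : BSlot γ PEv => s.2.1) h
    simpa [kslot, keyOf] using this
  rw [hinj (Finset.mem_coe.2 hc) (Finset.mem_coe.2 hc') hcell]

omit [DecidableEq α] [DecidableEq π] [DecidableEq γ] [DecidableEq δ] in
/-- the key map is injective on the live components of a term (distinct root cells). [folklore] -/
theorem injOn_keyOf (hinj : Set.InjOn (cellOf K τ) (liveC K τ : Set α)) :
    Set.InjOn (keyOf ped cellOf phys K τ) (liveC K τ : Set α) := fun _ hc _ hc' h =>
  hinj hc hc' (congrArg Prod.fst h)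

end Key

/-! ## §2 The distinct keys of bad terms' live components at a tree slot -/

section Occupants

variable {ι α π γ δ : Type*} [DecidableEq α] [DecidableEq π] [DecidableEq γ] [DecidableEq δ]

/-- **THE DISTINCT (ROOT CELL, FLAT GENEALOGY, PHYSICAL DATUM) TRIPLES OF BAD TERMS' LIVE COMPONENTS AT A TREE SLOT**
— the set row S6g′'s INSTANCE bounds; `HistoryAssemblyMult.gocc` for the key. [folklore] -/
def koccOf (ped : ℕ → ι → Pedigree α π) (liveC : ℕ → ι → Finset α) (cellOf : ℕ → ι → α → γ)
    (phys : ℕ → ι → α → δ) (jstar : ℕ → ℕ) (T : ℕ → Finset ι) (K : ℕ) (s : BSlot γ PEv) :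
    Finset (γ × Gen PEv × δ) :=
  gocc (memOf ped liveC cellOf) jstar T (kmemOf ped liveC cellOf phys) kslot K s

variable {ped : ℕ → ι → Pedigree α π} {liveC : ℕ → ι → Finset α} {cellOf : ℕ → ι → α → γ} {phys : ℕ → ι → α → δ}
  {jstar : ℕ → ℕ} {T : ℕ → Finset ι} {K : ℕ}

/-- **MEMBERSHIP**: a triple is an occupant of slot `s` iff it is the key of a live component of a BAD term (one with a
member born before `j⋆ K`) and its slot is `s`. [folklore] -/
theorem mem_koccOf {s : BSlot γ PEv} {w : γ × Gen PEv × δ} :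
    w ∈ koccOf ped liveC cellOf phys jstar T K s ↔
      ∃ τ ∈ badTerms (memOf ped liveC cellOf) jstar T K, ∃ c ∈ liveC K τ,
        keyOf ped cellOf phys K τ c = w ∧ kslot w = s := by
  rw [koccOf, mem_gocc]
  constructor
  · rintro ⟨τ, hτ, hw, hs⟩
    obtain ⟨c, hc, rfl⟩ := mem_kmemOf.1 hw
    exact ⟨τ, hτ, c, hc, rfl, hs⟩
  · rintro ⟨τ, hτ, c, hc, rfl, hs⟩
    exact ⟨τ, hτ, mem_kmemOf.2 ⟨c, hc, rfl⟩, hs⟩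

end Occupants

/-! ## §3 The kernel's price of a key: the maximum over its realisers -/

section SupPrice

variable {ι α π γ δ : Type*} [DecidableEq α] [DecidableEq π] [DecidableEq γ] [DecidableEq δ]

/-- **THE REALISERS OF A KEY**: the pairs (bad term, live component) carrying it. [folklore] -/
def realisersK (ped : ℕ → ι → Pedigree α π) (liveC : ℕ → ι → Finset α) (cellOf : ℕ → ι → α → γ)
    (phys : ℕ → ι → α → δ) (jstar : ℕ → ℕ) (T : ℕ → Finset ι) (K : ℕ) (w : γ × Gen PEv × δ) : Finset ((_ : ι) × α) :=
  ((badTerms (memOf ped liveC cellOf) jstar T K).sigma fun τ => liveC K τ).filter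
    fun x => keyOf ped cellOf phys K x.1 x.2 = w

/-- **THE KERNEL'S PRICE OF A KEY**: the MAXIMUM, over its realisers, of a named per-member price `pr` (the H3-side
printed price of the named member); `0` if it has no realiser. [folklore] -/
def supPriceK (ped : ℕ → ι → Pedigree α π) (liveC : ℕ → ι → Finset α) (cellOf : ℕ → ι → α → γ)
    (phys : ℕ → ι → α → δ) (jstar : ℕ → ℕ) (T : ℕ → Finset ι) (pr : ℕ → γ × Gen (Lab α π) → ℝ) (K : ℕ)
    (w : γ × Gen PEv × δ) : ℝ :=
  if h : (realisersK ped liveC cellOf phys jstar T K w).Nonempty then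
    (realisersK ped liveC cellOf phys jstar T K w).sup' h fun x => pr K (cellOf K x.1 x.2, (ped K x.1).genT x.2)
  else 0

variable {ped : ℕ → ι → Pedigree α π} {liveC : ℕ → ι → Finset α} {cellOf : ℕ → ι → α → γ} {phys : ℕ → ι → α → δ}
  {jstar : ℕ → ℕ} {T : ℕ → Finset ι} {pr : ℕ → γ × Gen (Lab α π) → ℝ} {K : ℕ}

/-- membership in the realisers. [folklore] -/
theorem mem_realisersK {w : γ × Gen PEv × δ} {x : (_ : ι) × α} :
    x ∈ realisersK ped liveC cellOf phys jstar T K w ↔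
      x.1 ∈ badTerms (memOf ped liveC cellOf) jstar T K ∧ x.2 ∈ liveC K x.1 ∧ keyOf ped cellOf phys K x.1 x.2 = w := by
  simp only [realisersK, mem_filter, mem_sigma, and_assoc]

/-- **EVERY REALISER'S NAMED PRICE IS BELOW THE KERNEL'S PRICE** of its key. [folklore] -/
theorem pr_le_supPriceK {τ : ι} (hτ : τ ∈ badTerms (memOf ped liveC cellOf) jstar T K) {c : α} (hc : c ∈ liveC K τ) :
    pr K (cellOf K τ c, (ped K τ).genT c) ≤
      supPriceK ped liveC cellOf phys jstar T pr K (keyOf ped cellOf phys K τ c) := by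
  have hx : (⟨τ, c⟩ : (_ : ι) × α) ∈ realisersK ped liveC cellOf phys jstar T K (keyOf ped cellOf phys K τ c) :=
    mem_realisersK.2 ⟨hτ, hc, rfl⟩
  unfold supPriceK
  rw [dif_pos ⟨_, hx⟩]
  exact le_sup' (fun x : (_ : ι) × α => pr K (cellOf K x.1 x.2, (ped K x.1).genT x.2)) hx

/-- the kernel's price is nonnegative for a nonnegative named price. [folklore] -/
theorem supPriceK_nonneg (hpr : ∀ q, 0 ≤ pr K q) (w : γ × Gen PEv × δ) :
    0 ≤ supPriceK ped liveC cellOf phys jstar T pr K w := by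
  unfold supPriceK
  split_ifs with h
  · obtain ⟨x, hx⟩ := h
    exact (hpr _).trans (le_sup' (fun x : (_ : ι) × α => pr K (cellOf K x.1 x.2, (ped K x.1).genT x.2)) hx)
  · exact le_rfl

/-- **THE KERNEL'S PRICE OF AN OCCUPANT IS ATTAINED BY A REALISER.** [folklore] -/
theorem exists_realiser_eq_supPriceK {s : BSlot γ PEv} {w : γ × Gen PEv × δ}
    (hw : w ∈ koccOf ped liveC cellOf phys jstar T K s) :
    ∃ τ ∈ badTerms (memOf ped liveC cellOf) jstar T K, ∃ c ∈ liveC K τ, keyOf ped cellOf phys K τ c = w ∧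
      supPriceK ped liveC cellOf phys jstar T pr K w = pr K (cellOf K τ c, (ped K τ).genT c) := by
  obtain ⟨τ, hτ, c, hc, hkey, -⟩ := mem_koccOf.1 hw
  have hne : (realisersK ped liveC cellOf phys jstar T K w).Nonempty := ⟨⟨τ, c⟩, mem_realisersK.2 ⟨hτ, hc, hkey⟩⟩
  obtain ⟨x, hx, heq⟩ := exists_mem_eq_sup' hne fun x : (_ : ι) × α => pr K (cellOf K x.1 x.2, (ped K x.1).genT x.2)
  obtain ⟨hx1, hx2, hx3⟩ := mem_realisersK.1 hx
  refine ⟨x.1, hx1, x.2, hx2, hx3, ?_⟩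
  unfold supPriceK
  rw [dif_pos hne, heq]

/-- **THE PER-TERM NAMED PRICE IS BELOW THE PRODUCT OF THE KERNEL'S PRICES OVER THE KEY FAMILY** (for a bad term
with distinct root cells and a nonnegative named price). [folklore] -/
theorem prod_memOf_le_prod_supPriceK (hpr : ∀ q, 0 ≤ pr K q) {τ : ι}
    (hτ : τ ∈ badTerms (memOf ped liveC cellOf) jstar T K) (hinj : Set.InjOn (cellOf K τ) (liveC K τ : Set α)) :
    ∏ q ∈ memOf ped liveC cellOf K τ, pr K q ≤
      ∏ w ∈ kmemOf ped liveC cellOf phys K τ, supPriceK ped liveC cellOf phys jstar T pr K w := by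
  rw [memOf, prod_image (injOn_named hinj), kmemOf, prod_image (injOn_keyOf hinj)]
  exact prod_le_prod (fun c _ => hpr _) fun c hc => pr_le_supPriceK hτ hc

/-- **THE GENERIC PER-OCCUPANT BINDER FROM A PER-REALISER BOUND**: if every live component `c` of every bad term
satisfies `#koccOf (slot of c) · pr K (named c) ≤ priceT … K (named c)`, then at every slot every occupant key `w`
satisfies `#koccOf s · supPriceK K w ≤ bslotPrice (yT …) s` (the arg-max realiser, `bslotOf_eq_kslot`, `priceT_le_yT`).
[folklore] -/
theorem hocc_of_boundK {C : T4PrintedShapeBanking.Consts} {Λ' : ℝ} {R : ℕ → ℕ → ℕ} {g : ℕ → ℕ → ℝ}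
    (hbound : ∀ τ ∈ badTerms (memOf ped liveC cellOf) jstar T K, ∀ c ∈ liveC K τ,
      ((koccOf ped liveC cellOf phys jstar T K (kslot (keyOf ped cellOf phys K τ c))).card : ℝ) *
          pr K (cellOf K τ c, (ped K τ).genT c) ≤
        priceT Prod.fst C Λ' R g K (cellOf K τ c, (ped K τ).genT c)) :
    ∀ s, ∀ w ∈ koccOf ped liveC cellOf phys jstar T K s,
      ((koccOf ped liveC cellOf phys jstar T K s).card : ℝ) * supPriceK ped liveC cellOf phys jstar T pr K w ≤
        bslotPrice (yT Prod.fst C Λ' R g (memOf ped liveC cellOf) jstar T K) s := by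
  intro s w hw
  obtain ⟨τ, hτ, c, hc, hkey, hsup⟩ := exists_realiser_eq_supPriceK (pr := pr) hw
  have hslot : kslot w = s := by
    obtain ⟨-, -, -, -, -, hs⟩ := mem_koccOf.1 hw
    exact hs
  have hq : (cellOf K τ c, (ped K τ).genT c) ∈ memOf ped liveC cellOf K τ := mem_memOf.2 ⟨c, hc, rfl⟩
  have hb := hbound τ hτ c hc
  rw [hkey, hslot] at hb
  rw [hsup]
  refine hb.trans ?_
  have hy := priceT_le_yT (sh := Prod.fst) (C := C) (Λ' := Λ') (R := R) (g := g) hτ hq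
  have hs' : s = bslotOf Prod.fst (cellOf K τ c, (ped K τ).genT c) := by
    rw [bslotOf_eq_kslot (ped K τ) (cellOf K τ c) c (phys K τ c), ← hslot, ← hkey]; rfl
  rw [hs']
  exact hy

end SupPrice

end

end Summit.QuantumFields.BalabanUV.T4Continuum.HistoryAssemblyMultKey
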